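import Mathlib
import Summits.AtomisticToContinuum.HydrodynamicLimit.Theorems.ImplosionDichotomyDenseExcursionR2Package

/-!
# Vocabulary of the line `sonic-cavity-renewal` (crux `DenseExcursion`, stmt-AtomisticToContinuum-12586) —
# the stub STATEMENTS' notions as importable definitions, and the proved glue `strip_of_box`

Definitions file (`--supports stmt-AtomisticToContinuum-12586`, line lead a2) for the registered skeleton
`Cruxes/DenseExcursion/Lines/sonic_cavity_renewal.lean` (v1, sha256 b15ffe79…; stubs `stub_boxPackage`, `stub_realBound`,
`stub_sonicConfinement`, `stub_cavityResolvent`, `stub_cavityTrapping`; composition `DenseExcursion_of : DenseExcursion`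
modulo exactly those) of the crux `Summit.AtomisticToContinuum.HydrodynamicLimit.Theses.ImplosionDichotomy.DenseExcursion`.
The five stub signatures are built from the notions below, which so far live only in the (non-importable) skeleton
workfile; this file lands them VERBATIM (same names, same bodies; the skeleton's next revision imports this module instead
of re-positing them) so that the seats proving the stubs can state and land their theorems against the tree:

* `OrigProfileEqs r W S` — the radial momentum and mass equations of the self-similar profile in original (unsolved)
  form (the inline hypothesis of `denseExcursion_of_package_of_tuning`, `gauge_isSmoothRadialMode`);
* `OneModeTwoConditionsStrip r W S` — the `(1, 2)` spectral package WITH a neutral strip `Re Λ > −δ₀` (verbatim the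
  r2 line's registered hypothesis, skeleton `r2_one_mode_two_conditions.lean` v9 §0a);
* `boxSide = 100`, `boxTop = 1000`, `InBox Λ` — the explicit compact box `−1/4 < Re Λ ≤ 100`, `|Im Λ| ≤ 1000`;
* `CavityTube r W S` — the finitely many certifiable quantitative facts about the pinned profile (sonic point at
  `x = 0`, repulsivity `κ ≥ 2/5`, CLGSS repulsivity margins, `C²` envelope on `x ≤ 1`, centre expansion, sonic
  analyticity with majorant `10^m`) that the analytic stubs consume;
* `BoxPackage r W S` — the `(1, 2)` package with exclusivity asserted only inside `InBox` (what a certified count delivers);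
* `RealBound r W S`, `SonicConfinement r W S` — the two ∀-lemmas (energy bound on `Re Λ`; `|Im Λ|`-confinement);
* `CavityResolvent r W S` — the constructive linear theory handed to the heart: uniform weighted-`C⁰` resolvent bounds
  with unique smooth centre-regular solvability on `{Re Λ ≥ −1/5}` minus three discs;
* `strip_of_box` (PROVED, pure logic): `IsMonatomicProfile ∧ BoxPackage ∧ RealBound ∧ SonicConfinement → OneModeTwoConditionsStrip`.

Mathematical commentary (line card `Lines/sonic-cavity-renewal.md`, idea card `Ideas/sonic-cavity-renewal.md`, TRIAGE-r2-1/2):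
the linearised radial operator `L = (linW, linS)` (`…R2Modes`) at the γ = 5/3 ground-state profile, sonic point normalised to
`x = 0`, read as Chen–Shkoller–Vicol's outgoing architecture at the repulsive sonic point with the core closed as a renewal
loop; the box numerals carry ≥ 100× slack over the measured loop gain `≈ 4.5 e^{−1.44 Re Λ}/|Im Λ|`.
Sources: Buckmaster–Cao-Labora–Gómez-Serrano 2025 Thm 1.1; Biasi 2021 §3; Cao-Labora–Gómez-Serrano–Shi–Staffilani
(arXiv:2310.05325) (1.6)–(1.9); Chen–Shkoller–Vicol arXiv:2605.00808 §1.10–1.11; Feller Vol. II Ch. XI (renewal theorem).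
NOT here: any proof of a stub (they land in their own files `--supports stmt-AtomisticToContinuum-12586`).
-/

noncomputable section

open Filter Set
open scoped Topology ContDiff

namespace Summit.AtomisticToContinuum.HydrodynamicLimit.Theorems.SonicCavityRenewal

open Summit.AtomisticToContinuum.HydrodynamicLimit.Theorems.R2OneModeTwoConditions

/-- The radial momentum and mass equations of the profile in ORIGINAL (unsolved) form — exactly the inline hypothesis of
`denseExcursion_of_package_of_tuning`, `gauge_isSmoothRadialMode`, `ScalingMode` (BCG eq. (1)/ζ and (2)/(3ζ) at ζ = eˣ;
PROVED for the BCG witness by `stub_profileEqs`). -/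
def OrigProfileEqs (r : ℝ) (W S : ℝ → ℝ) : Prop :=
  ∀ x, (W x - 1) * deriv W x + 3 * S x * deriv S x = r * W x - W x ^ 2 - 3 * S x ^ 2 ∧
    (1 - W x) * deriv S x - S x / 3 * deriv W x = S x * (2 * W x - r)

/-- THE `(1, 2)` PACKAGE WITH THE NEUTRAL STRIP — VERBATIM the r2 line's registered spectral hypothesis (skeleton v9 §0a):
`IsMonatomicProfile`, a real smooth radial mode `Λ₁ ∈ (6(r−1), 9(r−1))` (i.e. `2μ < Λ₁ < 3μ`, `μ = 3(r−1)`), algebraically simple,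
exclusivity of `{Λ₁, r, 0}` on a strip `Re Λ > −δ₀`, `δ₀ > 0`, the kernel at `0` = multiples of the scaling mode `(W′, S′)`, no Jordan
partner at `0`. Numerics (seven codes): `r₂ = 1.11281614862801`, `Λ₁ = 0.7971129142`, nearest stable smooth mode `−0.3172`. -/
def OneModeTwoConditionsStrip (r : ℝ) (W S : ℝ → ℝ) : Prop :=
  IsMonatomicProfile r W S ∧
  ∃ Λ₁ δ₀ : ℝ, 6 * (r - 1) < Λ₁ ∧ Λ₁ < 9 * (r - 1) ∧ 0 < δ₀ ∧
    (∃ ŵ ŝ : ℝ → ℂ, IsSmoothRadialMode r W S (Λ₁ : ℂ) ŵ ŝ) ∧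
    (∀ ŵ₁ ŝ₁ : ℝ → ℂ, IsSmoothRadialMode r W S (Λ₁ : ℂ) ŵ₁ ŝ₁ →
      ∀ ŵ₂ ŝ₂ : ℝ → ℂ, ¬ IsGeneralizedMode r W S (Λ₁ : ℂ) ŵ₁ ŝ₁ ŵ₂ ŝ₂) ∧
    (∀ Λ : ℂ, -δ₀ < Λ.re → (∃ ŵ ŝ : ℝ → ℂ, IsSmoothRadialMode r W S Λ ŵ ŝ) →
      Λ = (Λ₁ : ℂ) ∨ Λ = (r : ℂ) ∨ Λ = 0) ∧
    (∀ ŵ ŝ : ℝ → ℂ, IsSmoothRadialMode r W S 0 ŵ ŝ →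
      ∃ c : ℂ, ∀ x, ŵ x = c * ((deriv W x : ℝ) : ℂ) ∧ ŝ x = c * ((deriv S x : ℝ) : ℂ)) ∧
    (∀ ŵ₂ ŝ₂ : ℝ → ℂ,
      ¬ IsGeneralizedMode r W S 0 (fun x => ((deriv W x : ℝ) : ℂ)) (fun x => ((deriv S x : ℝ) : ℂ)) ŵ₂ ŝ₂)

/-- Right edge of the confinement box: no smooth radial mode has `Re Λ > boxSide` (energy bound, `stub_realBound`). Deliberately
generous (the L²-energy growth bound of the linearised flow on the ball `R ≤ e` is O(1–10)). -/
def boxSide : ℝ := 100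

/-- Height of the confinement box: smooth radial modes with `−1/4 < Re Λ ≤ boxSide` have `|Im Λ| ≤ boxTop` (`stub_sonicConfinement`).
Deliberately generous: the measured loop gain excludes zeros already for `|Im Λ| ≳ 6.4` at `Re Λ = −1/4` (TRIAGE-r2-1). -/
def boxTop : ℝ := 1000

/-- The compact box in which the certifier counts: `−1/4 < Re Λ ≤ boxSide`, `|Im Λ| ≤ boxTop` (strip depth `δ₀ = 1/4 < 0.2865`,
the first Evans pole `ν(Λ) = 4`, `< 0.3172`, the first stable smooth mode; c3-0 `SpectrumC3.md`). -/
def InBox (Λ : ℂ) : Prop :=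
  -(1 / 4 : ℝ) < Λ.re ∧ Λ.re ≤ boxSide ∧ |Λ.im| ≤ boxTop

/-- THE CAVITY TUBE — the finitely many CERTIFIABLE quantitative facts about the pinned profile that the analytic stubs consume
(all read off `SS(r₂)` with slack; sonic point normalised to `x = 0`, legitimate by the `x`-translation symmetry of
`IsMonatomicProfile`/`OrigProfileEqs` and of every spectral notion). Writing `s̃ x = eˣ·S x` (= `S̄/3`, bounded at the centre):
(a) SONIC POINT at `0`, unique and transversal with chord bound `3/8`, repulsivity `κ = −(W′+S′)(0) ≥ 2/5` (measured 0.41218);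
(b) CLGSS repulsivity (1.8)–(1.9) on the core + margin `x ≤ 1`: radial `1 − W − W′ − |S + S′| ≥ 3/8` (min 0.39525 at R = 1.028),
angular `1 − W − |S + S′| ≥ 5/8` (min 0.64826 at R = 1.050) — the certified inputs of the heart's energy estimates (NUMERICS-c4 §2);
(c) C² ENVELOPE on `x ≤ 1`: `|W| ≤ 1/4`, `|W′| ≤ 1/2`, `|W″| ≤ 6`, `7/10 ≤ s̃ ≤ 1`, `|s̃′| ≤ 1/4`, `|s̃″| ≤ 2`;
(d) CENTRE EXPANSION to second order in `e^{2x}` on `x ≤ 0` (`W`, `s̃` are smooth functions of `‖y‖² = e^{2x}`; `W(−∞) = r − 1`):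
remainder constant `2` (measured ratios ≤ 1.05);
(e) ANALYTICITY AT THE SONIC POINT with majorant `10^m` on the disc `|x| < 1/10` (BCG analytic branch; measured coefficient growth
`|a_m|^{1/m} → 7.0`, radius 0.14) — the input of the order-0 sonic relation / Frobenius recursion uniform in `Λ`. -/
def CavityTube (r : ℝ) (W S : ℝ → ℝ) : Prop :=
  -- (a) sonic point at 0: unique, transversal, repulsive
  W 0 + S 0 = 1 ∧
  (∀ x, x < 0 → 1 < W x + S x) ∧ (∀ x, 0 < x → W x + S x < 1) ∧
  (∀ x, x ≤ 1 → 3 / 8 * min |x| 1 ≤ |W x + S x - 1|) ∧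
  deriv W 0 + deriv S 0 ≤ -(2 / 5) ∧
  -- (b) radial and angular repulsivity on the core + margin
  (∀ x, x ≤ 1 → 3 / 8 ≤ 1 - W x - deriv W x - |S x + deriv S x|) ∧
  (∀ x, x ≤ 1 → 5 / 8 ≤ 1 - W x - |S x + deriv S x|) ∧
  -- (c) C² envelope on x ≤ 1
  (∀ x, x ≤ 1 → |W x| ≤ 1 / 4 ∧ |deriv W x| ≤ 1 / 2 ∧ |deriv (deriv W) x| ≤ 6) ∧
  (∀ x, x ≤ 1 → 7 / 10 ≤ Real.exp x * S x ∧ Real.exp x * S x ≤ 1 ∧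
    |deriv (fun y => Real.exp y * S y) x| ≤ 1 / 4 ∧ |deriv (deriv (fun y => Real.exp y * S y)) x| ≤ 2) ∧
  -- (d) centre expansion to second order in e^{2x}, x ≤ 0
  (∃ W₂ s₀ s₂ : ℝ, |W₂| ≤ 1 / 10 ∧ 7 / 10 ≤ s₀ ∧ s₀ ≤ 1 ∧ |s₂| ≤ 1 / 10 ∧ ∀ x, x ≤ 0 →
    |W x - (r - 1) - W₂ * Real.exp (2 * x)| ≤ 2 * Real.exp (4 * x) ∧
    |deriv W x - 2 * W₂ * Real.exp (2 * x)| ≤ 2 * Real.exp (4 * x) ∧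
    |deriv (deriv W) x - 4 * W₂ * Real.exp (2 * x)| ≤ 2 * Real.exp (4 * x) ∧
    |Real.exp x * S x - s₀ - s₂ * Real.exp (2 * x)| ≤ 2 * Real.exp (4 * x) ∧
    |deriv (fun y => Real.exp y * S y) x - 2 * s₂ * Real.exp (2 * x)| ≤ 2 * Real.exp (4 * x) ∧
    |deriv (deriv (fun y => Real.exp y * S y)) x - 4 * s₂ * Real.exp (2 * x)| ≤ 2 * Real.exp (4 * x)) ∧
  -- (e) analyticity at the sonic point with an explicit majorant
  (∃ a b : ℕ → ℝ, (∀ m, |a m| ≤ 10 ^ m ∧ |b m| ≤ 10 ^ m) ∧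
    ∀ x : ℝ, |x| < 1 / 10 → HasSum (fun m => a m * x ^ m) (W x) ∧ HasSum (fun m => b m * x ^ m) (S x))

/-- THE BOX PACKAGE — the `(1, 2)` strip package with its exclusivity clause asserted ONLY INSIDE the compact box `InBox`
(everything else verbatim): the object a certified computation can deliver (validated Evans enclosure of `Λ₁`, certified residue for
simplicity, argument principle on `∂(box)` with the pole-free normalisation `Ẽ = E·Π(ν(Λ) − m)`, kernel and Jordan exclusion at `0`;
NOTES-c5 §2 conjuncts 1, 2, 3, 5 and the compact half of 4). -/
def BoxPackage (r : ℝ) (W S : ℝ → ℝ) : Prop :=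
  ∃ Λ₁ : ℝ, 6 * (r - 1) < Λ₁ ∧ Λ₁ < 9 * (r - 1) ∧
    (∃ ŵ ŝ : ℝ → ℂ, IsSmoothRadialMode r W S (Λ₁ : ℂ) ŵ ŝ) ∧
    (∀ ŵ₁ ŝ₁ : ℝ → ℂ, IsSmoothRadialMode r W S (Λ₁ : ℂ) ŵ₁ ŝ₁ →
      ∀ ŵ₂ ŝ₂ : ℝ → ℂ, ¬ IsGeneralizedMode r W S (Λ₁ : ℂ) ŵ₁ ŝ₁ ŵ₂ ŝ₂) ∧
    (∀ Λ : ℂ, InBox Λ → (∃ ŵ ŝ : ℝ → ℂ, IsSmoothRadialMode r W S Λ ŵ ŝ) →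
      Λ = (Λ₁ : ℂ) ∨ Λ = (r : ℂ) ∨ Λ = 0) ∧
    (∀ ŵ ŝ : ℝ → ℂ, IsSmoothRadialMode r W S 0 ŵ ŝ →
      ∃ c : ℂ, ∀ x, ŵ x = c * ((deriv W x : ℝ) : ℂ) ∧ ŝ x = c * ((deriv S x : ℝ) : ℂ)) ∧
    (∀ ŵ₂ ŝ₂ : ℝ → ℂ,
      ¬ IsGeneralizedMode r W S 0 (fun x => ((deriv W x : ℝ) : ℂ)) (fun x => ((deriv S x : ℝ) : ℂ)) ŵ₂ ŝ₂)

/-- REAL-PART BOUND: every smooth radial mode has `Re Λ ≤ boxSide` (weighted `L²` energy identity on the ball `R ≤ e`, outflow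
boundary, Grönwall constant from the CavityTube envelope). -/
def RealBound (r : ℝ) (W S : ℝ → ℝ) : Prop :=
  ∀ (Λ : ℂ) (ŵ ŝ : ℝ → ℂ), IsSmoothRadialMode r W S Λ ŵ ŝ → Λ.re ≤ boxSide

/-- `|Im Λ|`-CONFINEMENT (the card's First lemma, typed with the EXPLICIT box per TRIAGE-r2-1 sharpen (1)/(2) and r2-2 sharpen (1)):
every smooth radial mode with `−1/4 < Re Λ ≤ boxSide` has `|Im Λ| ≤ boxTop`. -/
def SonicConfinement (r : ℝ) (W S : ℝ → ℝ) : Prop :=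
  ∀ (Λ : ℂ) (ŵ ŝ : ℝ → ℂ), IsSmoothRadialMode r W S Λ ŵ ŝ → -(1 / 4 : ℝ) < Λ.re → Λ.re ≤ boxSide → |Λ.im| ≤ boxTop

/-- THE CAVITY RESOLVENT — the constructive linear theory this line hands to the heart (renewal / Paley–Wiener content, stated on the
Laplace side, ODE level): for the package rate `Λ₁` there is ONE constant `C` such that for every `Λ` in the closed strip
`Re Λ ≥ −1/5` outside the `1/20`-discs around the three residues `0`, `Λ₁`, `r`, and every smooth centre-regular source `(f, g)` whose
weighted sup on the core + margin `x ≤ 1` is `≤ N` (weights `1` on the `w`-component and `eˣ` on the `s`-component — the bounded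
quantities of a regular pair at the centre), the resolvent equation `(Λ − L)(ŵ, ŝ) = (f, g)` (`L = (linW, linS)`) has a smooth
centre-regular solution on `ℝ`, UNIQUE on `x ≤ 1`, with weighted sup `≤ C·N` there — uniformly in `Λ` (in particular as
`|Im Λ| → ∞`: loop gain `→ 0`) and with NO loss of derivatives (transport along characteristics; the smooth branch at the repulsive
sonic point costs `1/(κ·Re ν)`-type constants only on compact `Λ`-sets, handled by analyticity in `Λ` across the jet resonances
`ν(Λ) ∈ ℕ`). Laplace inversion along `Re Λ = −1/5` (two integrations by parts in `τ`) then gives the time-domain trichotomy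
`e^{τL}v₀ = (residues at Λ₁, r, 0) + O_{C⁰_w}(e^{−τ/5}‖v₀‖_{C²_w})` inside the heart — Gearhart–Prüss-free. -/
def CavityResolvent (r : ℝ) (W S : ℝ → ℝ) : Prop :=
  ∀ Λ₁ : ℝ, 6 * (r - 1) < Λ₁ → Λ₁ < 9 * (r - 1) → (∃ ŵ ŝ : ℝ → ℂ, IsSmoothRadialMode r W S (Λ₁ : ℂ) ŵ ŝ) →
    ∃ C : ℝ, 0 < C ∧ ∀ Λ : ℂ, -(1 / 5 : ℝ) ≤ Λ.re → (1 / 20 : ℝ) ≤ ‖Λ‖ → (1 / 20 : ℝ) ≤ ‖Λ - (Λ₁ : ℂ)‖ →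
      (1 / 20 : ℝ) ≤ ‖Λ - (r : ℂ)‖ →
      ∀ (f g : ℝ → ℂ), IsRegularPair f g → ∀ N : ℝ, (∀ y, y ≤ 1 → ‖f y‖ + Real.exp y * ‖g y‖ ≤ N) →
        ∃ ŵ ŝ : ℝ → ℂ, IsRegularPair ŵ ŝ ∧
          (∀ x, Λ * ŵ x - linW r W S ŵ ŝ x = f x ∧ Λ * ŝ x - linS r W S ŵ ŝ x = g x) ∧
          (∀ x, x ≤ 1 → ‖ŵ x‖ + Real.exp x * ‖ŝ x‖ ≤ C * N) ∧
          (∀ ŵ' ŝ' : ℝ → ℂ, IsRegularPair ŵ' ŝ' →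
            (∀ x, Λ * ŵ' x - linW r W S ŵ' ŝ' x = f x ∧ Λ * ŝ' x - linS r W S ŵ' ŝ' x = g x) →
            ∀ x, x ≤ 1 → ŵ' x = ŵ x ∧ ŝ' x = ŝ x)

/-! ## Glue (proved): the box package + the two analytic bounds = the strip package -/

/-- The strip package follows from the pinned box package, the real-part bound and the `|Im Λ|`-confinement: a smooth radial mode
with `Re Λ > −1/4` has `Re Λ ≤ boxSide` (`RealBound`) and then `|Im Λ| ≤ boxTop` (`SonicConfinement`), so it lies in the box, where
the certified count applies. Witness `δ₀ := 1/4`. Pure logic (registered sub-goal `strip_of_box` of stmt-AtomisticToContinuum-12586). -/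
theorem strip_of_box : ∀ {r : ℝ} {W S : ℝ → ℝ}, IsMonatomicProfile r W S → BoxPackage r W S → RealBound r W S →
    SonicConfinement r W S → OneModeTwoConditionsStrip r W S := by
  intro r W S hP hbox hre him
  obtain ⟨Λ₁, h6, h9, hmode, hsimple, hexcl, hker, hjordan⟩ := hbox
  refine ⟨hP, Λ₁, 1 / 4, h6, h9, by norm_num, hmode, hsimple, ?_, hker, hjordan⟩
  intro Λ hΛ hex
  obtain ⟨ŵ, ŝ, hm⟩ := hex
  have h1 : Λ.re ≤ boxSide := hre Λ ŵ ŝ hm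
  have h2 : |Λ.im| ≤ boxTop := him Λ ŵ ŝ hm (by simpa using hΛ) h1
  exact hexcl Λ ⟨by simpa using hΛ, h1, h2⟩ ⟨ŵ, ŝ, hm⟩

/-- The strip package of the box has depth exactly `1/4 ≥ 1/5`: the form in which `stub_cavityResolvent` (v2) consumes it. Same proof,
recorded with the explicit `δ₀` so that no consumer has to re-open the existential. -/
theorem strip_quarter_of_box {r : ℝ} {W S : ℝ → ℝ} (hbox : BoxPackage r W S) (hre : RealBound r W S)
    (him : SonicConfinement r W S) :
    ∀ Λ : ℂ, -(1 / 4 : ℝ) < Λ.re → (∃ ŵ ŝ : ℝ → ℂ, IsSmoothRadialMode r W S Λ ŵ ŝ) →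
      ∃ Λ₁ : ℝ, (6 * (r - 1) < Λ₁ ∧ Λ₁ < 9 * (r - 1)) ∧ (Λ = (Λ₁ : ℂ) ∨ Λ = (r : ℂ) ∨ Λ = 0) := by
  intro Λ hΛ hex
  obtain ⟨Λ₁, h6, h9, -, -, hexcl, -, -⟩ := hbox
  obtain ⟨ŵ, ŝ, hm⟩ := hex
  have h1 : Λ.re ≤ boxSide := hre Λ ŵ ŝ hm
  have h2 : |Λ.im| ≤ boxTop := him Λ ŵ ŝ hm hΛ h1
  exact ⟨Λ₁, ⟨h6, h9⟩, hexcl Λ ⟨hΛ, h1, h2⟩ ⟨ŵ, ŝ, hm⟩⟩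

/-- The strip package implies the landed half-plane package `OneModeTwoConditions` (`…R2Package`): forget the strip below `0`
(verbatim the r2 skeleton v8c / packing-analytic-implosion skeleton v1 `strip_imp_package`). -/
theorem strip_imp_package {r : ℝ} {W S : ℝ → ℝ} (h : OneModeTwoConditionsStrip r W S) :
    OneModeTwoConditions r W S := by
  obtain ⟨hP, Λ₁, δ₀, h6, h9, hδ, hmode, hsimple, hstrip, -, -⟩ := h
  refine ⟨hP, Λ₁, h6, h9, hmode, hsimple, fun Λ hΛ hex => ?_⟩
  rcases hstrip Λ (by linarith) hex with h1 | h2 | h3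
  · exact Or.inl h1
  · exact Or.inr h2
  · exact absurd hΛ (by rw [h3]; simp)

end Summit.AtomisticToContinuum.HydrodynamicLimit.Theorems.SonicCavityRenewal

end
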